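import Literature.MathematicalPhysics.QuantumFieldTheory.Balaban1983to89.B8Ineq159PeriodizedTowerReads

/-!
# `Balaban1983to89.B8Ineq159PeriodizedTowerClass` — [Balaban1985RegularSpaces] (1.31) p. 82, (1.38) p. 82, (1.131) p. 99, p. 77 («we admit the case when some
# domains Ω_j are equal to T_η»): PRINT'S CLASS (1.31) `towerBondsP` OVER THE PERIODISED SECT.-F TOWER `Ωᴾ = periodize (fun _ ↦ P) (cubeFam true L a M ρ k)`
# AND THE LANDAU TRANSFER (1.38) from `(Ωᴾ₀ = T, Lam L Ωᴾ k)` to every translate cube member `{□_j(a + q•v)}` — file (A2) of the dictionary whose file (A1) is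
# `B8Ineq159PeriodizedTowerReads`

statement-level skeleton of published theorems with citation tags; proofs where landed; nothing here is a claim about the
Yang–Mills mass gap

`[Balaban1985RegularSpaces]` ("B8", CMP **99** (1985) 75–102): p. 77, (1.3)–(1.6) p. 77, (1.7) p. 77, (1.31) p. 82, (1.38) p. 82, (1.131) p. 99 («Λ′₀ = T ∖ □₁»),
p. 98; [4] = `[Balaban1985BackgroundPropagators]` (3.19) p. 393, (3.23)–(3.25) p. 394; [B6] = `[Balaban1984PropagatorsII]` (2.1)–(2.3) p. 224; [B7] =
`[Balaban1985Averaging]` p. 24 (the box `B(c₋) ∪ B(c₊)`), Prop. 5 p. 42; [B11] = `[Balaban1985Variational]` (3) p. 278.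

CITATION HEADER (lean-in-tree rule).  Cell `pub-ymgap` (YM Track A, HUMAN RULING D-0062 ∕ D-0149), DAG node N05 = [B8], width seat `pub-ymgap-dag-n05-w3`
(g5), CLAIM-1 file (A2); director-ym №217 (1) «(β′-PERIODIC) is the road of record behind the [B8] display».  WHY.  The companion
`B8SockB9P3H2AtPeriodizedTower` runs this lineage's top-cube socket proof translate-wise over the periodised Sect.-F tower; it needs (i) that the translate
member's constraint-bond class `cubeLamBP (a + q•v) … k j` lies in print's class `towerBondsP L Ωᴾ (Lam L Ωᴾ k) j` (so the socket's average family `|B₁|`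
dominates the per-cube targets), (ii) that the fine box of every class bond of `Ωᴾ` lies in `Ωᴾ_{j−1}` (the [B7] Prop. 5 regime bounding that family — the
single tower's finiteness of the class fails here), and (iii) the transfer of the Landau condition (1.38) from the periodised tower to each translate cube member
for the cut-off field.  File (A1) supplies the separation, the level sets and the touching decomposition.

THE MATHEMATICS (kernel-checked).  §1 PRINT'S CLASS (1.31) over `Ωᴾ`: `towerBondsP_of_imp` (monotonicity along the points the class reads); level-`0` class bonds =
bonds with both ends off every `□₁(a + q•w)`; ★ `cubeLamBP_translate_subset_towerBondsP_periodize` (levels `1 ≤ j ≤ k`: positive transfer of this lineage's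
`cubeLamBP_subset_towerBondsP_topCube_of_le` at the single tower over `a + q•v` — every point the membership reads lies in `□₀(a + q•v)`, where (A1) §3 makes
the periodised tower's level sets agree with the single tower's), ★ `cubeLamBP_translate_zero_subset_towerBondsP_periodize` (level `0`, by (A1) §2), and the box
lemma `box_subset_periodize_pred_of_mem_towerBondsP`.  §2 ★★ `isLandau138_cube_of_periodize` — THE LANDAU TRANSFER: (1.38) in multiplier form at `(Ωᴾ₀ = T,
Lam L Ωᴾ k)` for `A` implies (1.38) of the translate cube member `(□₀(a + q•v), cubeLamS … k)` for any `A′` agreeing with `A` on the bonds touching `□₀(a + q•v)`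
— this seat's g4 `isLandau138_cube_of_univ` with the literal equalities of the restriction sets replaced by the block-label locality of `Q′ᵀ` (`QprimeT_congr_fun`)
and (A1) §3, and the level-`0` multiplier vanishing on `□₁(a + q•v) ⊂ Ωᴾ₁`.

HONEST SCOPE.  Lattice ∕ multiplier bookkeeping only: no estimate of [B8] ∕ [4] is proved here; nothing of Bałaban's asserted; no index ∕ pin ∕ door ∕ model of the
periodic road typed; count-neutral; N05 NOT discharged; one finite `𝕋⁴` programme at fixed `ε`, Bałaban as printed; the YM mass gap (Clay) is NOT proved by any of
this — R4 closes the conditional finite-`𝕋⁴` rung `BalabanLadder.UV` only; nothing continuum ∕ ℝ⁴ ∕ OS.  No `sorry`, no `def`, no `instance`, no `notation`.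
Unit `pub-ymgap-dag-n05-w3` (g5), 2026-08-28.
-/

noncomputable section

namespace Literature.MathematicalPhysics.QuantumFieldTheory.Balaban1983to89.B8Ineq159PeriodizedTowerClass

open B7Prop1Explicit B7Prop2Explicit B7Prop1Local B7Eq78Linearization
open B8Ineq132 (covDerivFwd covDeriv BondTouches PlaqTouches Under)
open B8Eq140Level (SideTouches IsSide sideTouches_of_bondTouches)
open B8Eq138LandauZd (IsLandau138 QT QprimeT covDivB covLap)
open B8Eq131CubesAdmissible (cubeFam cubeFam_true_zero cubeFam_false_zero cubeFam_false_of_le cubeFam_of_pos cubeFam_of_lt smul_mem_cube_iff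
  smul_mem_cube_succ_iff)
open B8Eq131Cubes (cube sqLo sqHi inLo inHi bLo bHi gs cube_anti cube_eq cube_succ_subset one_le_gs)
open B8CubeMemberZd (cubeLamS cubeLam cubeLamS_top mem_cubeLam_zero_iff inBox_sq_of_mem_cubeLamS)
open B8Ineq159FlatCubeMemberPrinted (cubeLamBP cubeLamBP_box_subset_pred)
open B8Ineq159FlatCubeMemberKernel (inBox_in_zero_iff blockMap_pow_smul_self)
open B8Ineq159CurvedCubeMemberLocalTower (QprimeT_congr_fun)
open B8IdxB8SubDRigidity (loK_eq_smul)
open B8TowerBondsPrinted (towerBondsP)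
open B8Ineq159TopCubeTowerReads (near_mem_cube_zero add_e_mem_cube_zero covDivB_congr_fld covLap_congr_fld cubeLamBP_subset_towerBondsP_topCube_of_le)
open B15LatticeCubeTorus (periodize)
open B8Thm2LogB (blockTop)
open Literature.MathematicalPhysics.QuantumLattice (blockMap)
open B8Ineq159PeriodizedTowerReads

-- `Site` alone would resolve to the torus sites of `Setup.lean`; re-export the `ℤ^d` sites of `B7Prop1Explicit`.
export B7Prop1Explicit (Site)

variable {d : ℕ}

/-! ## §1 Print's class (1.31) `towerBondsP` over the periodised tower -/

section TowerBonds

/-- **`towerBondsP` is monotone in its data ALONG THE POINTS IT READS**: the fine box (in `Ω_j` ∕ `Ω_{j−1}`), the two ends (in `Λ_j`) and the `L`-blocks under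
the ends (in `Λ_{j−1}`) — the transfer used to pass from the single tower over `a + q•v` to `Ωᴾ`. [cite: Balaban1985RegularSpaces, (1.31) p.82; Balaban1984PropagatorsII, (2.3) p.224] -/
theorem towerBondsP_of_imp (L : ℕ) {Ω Ω' Λ Λ' : ℕ → Set (Site d)} (j : ℕ) (c : Site d × Fin d)
    (hΩj : ∀ x, InBox (loK L j c.1) (bondHiK L j c.1 c.2) x → x ∈ Ω j → x ∈ Ω' j)
    (hΩj' : ∀ x, InBox (loK L j c.1) (bondHiK L j c.1 c.2) x → x ∈ Ω (j - 1) → x ∈ Ω' (j - 1))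
    (hΛa : c.1 ∈ Λ j → c.1 ∈ Λ' j) (hΛb : c.1 + e c.2 ∈ Λ j → c.1 + e c.2 ∈ Λ' j)
    (hΛc : ∀ j', j = j' + 1 → ∀ x, (L : ℤ) • c.1 ≤ x → x ≤ (L : ℤ) • c.1 + blockTop L → x ∈ Λ j' → x ∈ Λ' j')
    (hΛd : ∀ j', j = j' + 1 → ∀ x, (L : ℤ) • (c.1 + e c.2) ≤ x → x ≤ (L : ℤ) • (c.1 + e c.2) + blockTop L → x ∈ Λ j' → x ∈ Λ' j')
    (h : c ∈ towerBondsP L Ω Λ j) : c ∈ towerBondsP L Ω' Λ' j := by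
  rcases h with ⟨hb, h1, h2⟩ | ⟨hb, ⟨j', hj, hx, hy⟩ | ⟨j', hj, hy, hx⟩⟩
  · exact Or.inl ⟨fun x hxb => hΩj x hxb (hb x hxb), hΛa h1, hΛb h2⟩
  · exact Or.inr ⟨fun x hxb => hΩj' x hxb (hb x hxb), Or.inl ⟨j', hj, fun x hx1 hx2 => hΛc j' hj x hx1 hx2 (hx x hx1 hx2), hΛb hy⟩⟩
  · exact Or.inr ⟨fun x hxb => hΩj' x hxb (hb x hxb), Or.inr ⟨j', hj, hΛa hy, fun x hx1 hx2 => hΛd j' hj x hx1 hx2 (hx x hx1 hx2)⟩⟩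

/-- ★ **LEVEL `0` OF PRINT'S CLASS OVER `Ωᴾ`: a bond with both ends off every `□₁(a + q•w)` is a level-`0` class bond** (box clause `Ωᴾ₀ = T`, ends in
`Lam L Ωᴾ k 0 = (⋃_w □₁(a + q•w))ᶜ`; there `LʲηQ_j(U₀)B` is the field itself). [cite: Balaban1985RegularSpaces, (1.31) p.82, (1.131) p.99; Balaban1984PropagatorsII, (2.3) p.224] -/
theorem mem_towerBondsP_periodize_zero_of_ends {L : ℕ} (a : Site d) (M ρ : ℕ) {k P : ℕ} {q : ℤ} (hq : (L : ℤ) ^ k * q = P) (hk : 1 ≤ k)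
    {c : Site d × Fin d} (h1 : ∀ w : Site d, c.1 ∉ cube L (a + q • w) M ρ k 1) (h2 : ∀ w : Site d, c.1 + e c.2 ∉ cube L (a + q • w) M ρ k 1) :
    c ∈ towerBondsP L (periodize (fun _ : Fin d => P) (cubeFam true L a M ρ k))
      (B11Eq7Convention.Lam L (periodize (fun _ : Fin d => P) (cubeFam true L a M ρ k)) k) 0 :=
  Or.inl ⟨fun x _ => by rw [periodize_cubeFam_true_zero]; exact Set.mem_univ x,
    (mem_lam_periodize_zero_iff a M ρ hq hk _).2 h1, (mem_lam_periodize_zero_iff a M ρ hq hk _).2 h2⟩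

/-- The sites of the two `L`-blocks under the ends of a level-`1` bond lie in its fine box. [cite: Balaban1985Averaging, p.24 (the box `B(c₋) ∪ B(c₊)`)] -/
private theorem inBox_one_of_block (L : ℕ) (c : Site d × Fin d) {x : Site d}
    (h : ((L : ℤ) • c.1 ≤ x ∧ x ≤ (L : ℤ) • c.1 + blockTop L) ∨
      ((L : ℤ) • (c.1 + e c.2) ≤ x ∧ x ≤ (L : ℤ) • (c.1 + e c.2) + blockTop L)) :
    InBox (loK L 1 c.1) (bondHiK L 1 c.1 c.2) x := by
  have hL0 : (0 : ℤ) ≤ (L : ℤ) := by positivity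
  intro i
  simp only [loK, bondHiK, pow_one]
  rcases h with ⟨h1, h2⟩ | ⟨h1, h2⟩
  · have a1 := h1 i
    have a2 := h2 i
    simp only [Pi.smul_apply, smul_eq_mul, Pi.add_apply, blockTop] at a1 a2
    refine ⟨a1, a2.trans ?_⟩
    split_ifs <;> linarith
  · have a1 := h1 i
    have a2 := h2 i
    simp only [Pi.smul_apply, smul_eq_mul, Pi.add_apply, blockTop, e_apply] at a1 a2
    by_cases hi : i = c.2
    · rw [if_pos hi] at a1 a2; rw [if_pos hi]; constructor <;> linarith
    · rw [if_neg hi] at a1 a2; rw [if_neg hi]; constructor <;> linarith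

/-- ★★ **THE TRANSLATE MEMBER'S CLASS LIES IN PRINT'S CLASS OVER THE PERIODISED TOWER** (levels `1 ≤ j ≤ k`): `cubeLamBP (a + q•v) … k j ⊆
towerBondsP L Ωᴾ (Lam L Ωᴾ k) j`.  The bond lies in print's class over the SINGLE tower over `a + q•v` (g0∕g4's `cubeLamBP_subset_towerBondsP_topCube_of_le`);
every point that membership reads — the fine box, the ends, the blocks under the ends — lies in `□₀(a + q•v)` (the box lemma `cubeLamBP_box_subset_pred`),
where the periodised tower's data agree with the single tower's (file (A1)). [cite: Balaban1985RegularSpaces, (1.31) p.82, (1.131) p.99, p.98; Balaban1984PropagatorsII, (2.3) p.224] -/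
theorem cubeLamBP_translate_subset_towerBondsP_periodize {L : ℕ} (hL : 1 ≤ L) (a : Site d) (M : ℕ) {ρ : ℕ} (hρ : L ≤ ρ) {k P : ℕ} {q : ℤ}
    (hq : (L : ℤ) ^ k * q = P) (hP : L ^ k * M + 2 * (ρ * gs L k) ≤ P) (v : Site d) {j : ℕ} (hj1 : 1 ≤ j) (hjk : j ≤ k) :
    cubeLamBP L (a + q • v) M ρ k k j ⊆ towerBondsP L (periodize (fun _ : Fin d => P) (cubeFam true L a M ρ k))
      (B11Eq7Convention.Lam L (periodize (fun _ : Fin d => P) (cubeFam true L a M ρ k)) k) j := by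
  classical
  intro c hc
  -- print's class over the SINGLE tower over `a + q•v`, with dag-n05-c's explicit families
  let Λv : ℕ → Set (Site d) := fun i => if i = 0 then (cube L (a + q • v) M ρ k 1)ᶜ else cubeLamS L (a + q • v) M ρ k k i
  have hΛv0 : Λv 0 = (cube L (a + q • v) M ρ k 1)ᶜ := by simp [Λv]
  have hΛv : ∀ i, 1 ≤ i → i ≤ k → Λv i = cubeLamS L (a + q • v) M ρ k k i := fun i hi _ => by simp [Λv, show i ≠ 0 by omega]
  have h0 := cubeLamBP_subset_towerBondsP_topCube_of_le hL (a + q • v) M hρ hΛv0 hΛv hj1 hjk hc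
  -- everything the class reads lies in `□₀(a + q•v)`
  have hbox : ∀ x, InBox (loK L j c.1) (bondHiK L j c.1 c.2) x → x ∈ cube L (a + q • v) M ρ k 0 := fun x hx =>
    cube_anti (Nat.zero_le _) (by omega) (cubeLamBP_box_subset_pred hL (a + q • v) M hρ hj1 le_rfl hc x hx)
  have hlab : ∀ {i : ℕ}, 1 ≤ i → i ≤ k → ∀ {z : Site d}, z ∈ Λv i →
      z ∈ B11Eq7Convention.Lam L (periodize (fun _ : Fin d => P) (cubeFam true L a M ρ k)) k i := by
    intro i hi hik z hz
    rw [hΛv i hi hik] at hz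
    exact mem_lam_periodize_of_mem_cubeLamS hL a M hρ hq hP v hi hik hz
  -- the level-`0` reading (only for `j = 1`): fine sites of the blocks under the ends, inside the box, off `□₁(a + q•v)`
  have hzero : ∀ x, InBox (loK L j c.1) (bondHiK L j c.1 c.2) x → x ∈ Λv 0 →
      x ∈ B11Eq7Convention.Lam L (periodize (fun _ : Fin d => P) (cubeFam true L a M ρ k)) k 0 := by
    intro x hxb hx
    rw [hΛv0] at hx
    refine (mem_lam_periodize_zero_iff a M ρ hq (by omega) x).2 fun w => ?_
    by_cases hwv : v = w
    · subst hwv; exact hx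
    · exact not_mem_cube_translate_of_mem_cube_zero a M hq hP (hbox x hxb) hwv (by omega)
  refine towerBondsP_of_imp L j c (fun x _ hx => cubeFam_translate_subset_periodize a M ρ k hq v j hx)
    (fun x _ hx => cubeFam_translate_subset_periodize a M ρ k hq v (j - 1) hx) (hlab hj1 hjk) (hlab hj1 hjk) ?_ ?_ h0
  · intro j' hj x hx1 hx2 hx
    rcases Nat.eq_zero_or_pos j' with rfl | hj'
    · rw [Nat.zero_add] at hj; subst hj
      exact hzero x (inBox_one_of_block L c (Or.inl ⟨hx1, hx2⟩)) hx
    · exact hlab hj' (by omega) hx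
  · intro j' hj x hx1 hx2 hx
    rcases Nat.eq_zero_or_pos j' with rfl | hj'
    · rw [Nat.zero_add] at hj; subst hj
      exact hzero x (inBox_one_of_block L c (Or.inr ⟨hx1, hx2⟩)) hx
    · exact hlab hj' (by omega) hx

/-- ★ **LEVEL `0` OF THE TRANSLATE MEMBER'S CLASS LIES IN PRINT'S CLASS OVER `Ωᴾ`**: a bond of `cubeLamBP (a + q•v) … k 0` (an end in `□₀^{(0)}`, no end in
`□₁^{(0)}`) has both ends off every `□₁(a + q•w)` — an end inside `□₀(a + q•v)` by separation, an end outside by adjacency (file (A1) §2).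
[cite: Balaban1985RegularSpaces, (1.31) p.82, (1.131) p.99; Balaban1984PropagatorsII, (2.3) p.224] -/
theorem cubeLamBP_translate_zero_subset_towerBondsP_periodize {L : ℕ} (hL : 1 ≤ L) (a : Site d) (M : ℕ) {ρ : ℕ} (hρ : L ≤ ρ) {k P : ℕ} {q : ℤ}
    (hq : (L : ℤ) ^ k * q = P) (hP : L ^ k * M + 2 * (ρ * gs L k) ≤ P) (hk : 1 ≤ k) (v : Site d) :
    cubeLamBP L (a + q • v) M ρ k k 0 ⊆ towerBondsP L (periodize (fun _ : Fin d => P) (cubeFam true L a M ρ k))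
      (B11Eq7Convention.Lam L (periodize (fun _ : Fin d => P) (cubeFam true L a M ρ k)) k) 0 := by
  intro c hc
  have hρ1 : 1 ≤ ρ := hL.trans hρ
  obtain ⟨-, hends, hdeep⟩ := hc
  obtain ⟨hd1, hd2⟩ := hdeep (by omega)
  rw [inBox_in_zero_iff hL _ M ρ hk] at hd1 hd2
  -- an end in `□₀^{(0)}` is a fine site of `□₀(a + q•v)` (`L⁰ = 1`)
  have hsq : ∀ y : Site d, InBox (sqLo L (a + q • v) ρ k 0) (sqHi L (a + q • v) M ρ k 0) y → y ∈ cube L (a + q • v) M ρ k 0 := fun y hy => by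
    have h := (smul_mem_cube_iff hL (a + q • v) M ρ k 0 y).2 hy
    rwa [pow_zero, one_smul] at h
  -- each end lies in no translate's `□₁`
  have key : ∀ y t : Site d, (∀ i, |t i| ≤ 1) → y ∉ cube L (a + q • v) M ρ k 1 →
      (y ∈ cube L (a + q • v) M ρ k 0 ∨ (y + (-t) ∈ cube L (a + q • v) M ρ k 0)) → ∀ w : Site d, y ∉ cube L (a + q • w) M ρ k 1 := by
    intro y t ht hy1 hy w
    by_cases hy0 : y ∈ cube L (a + q • v) M ρ k 0
    · by_cases hwv : v = w
      · subst hwv; exact hy1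
      · exact not_mem_cube_translate_of_mem_cube_zero a M hq hP hy0 hwv hk
    · rcases hy with hy | hy
      · exact absurd hy hy0
      · have h := not_mem_cube_one_translate_of_adj a M hq hP hρ1 hk hy ht (by rw [neg_add_cancel_right]; exact hy0) w
        rwa [neg_add_cancel_right] at h
  have he : ∀ i, |(e c.2 : Site d) i| ≤ 1 := fun i => by rw [e_apply]; split_ifs <;> simp
  have hne : ∀ i, |(-e c.2 : Site d) i| ≤ 1 := fun i => by rw [Pi.neg_apply, abs_neg]; exact he i
  refine mem_towerBondsP_periodize_zero_of_ends a M ρ hq hk (key c.1 (-e c.2) hne hd1 ?_) (key (c.1 + e c.2) (e c.2) he hd2 ?_)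
  · rcases hends with h | h
    · exact Or.inl (hsq _ h)
    · exact Or.inr (by rw [neg_neg]; exact hsq _ h)
  · rcases hends with h | h
    · exact Or.inr (by rw [add_neg_cancel_right]; exact hsq _ h)
    · exact Or.inl (hsq _ h)

/-- **The fine box of a class bond of level `j` over `Ωᴾ` lies in `Ωᴾ_{j−1}`** (inner bonds: `Ωᴾ_j ⊆ Ωᴾ_{j−1}`; crossing bonds: by definition) — the box
condition of [B7] Prop. 5 in the shifted regime (`B9Eq316AveragingTransposeZd.norm_linCovIter_le_of_reg17`).
[cite: Balaban1985RegularSpaces, (1.31) p.82, (1.7) p.77; Balaban1984PropagatorsII, (2.3) p.224; Balaban1985Averaging, Prop. 5 p.42] -/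
theorem box_subset_periodize_pred_of_mem_towerBondsP {L : ℕ} (a : Site d) (M ρ k : ℕ) {P : ℕ} {q : ℤ} (hq : (L : ℤ) ^ k * q = P)
    {Λ : ℕ → Set (Site d)} {j : ℕ} {c : Site d × Fin d}
    (h : c ∈ towerBondsP L (periodize (fun _ : Fin d => P) (cubeFam true L a M ρ k)) Λ j) :
    ∀ x, InBox (loK L j c.1) (bondHiK L j c.1 c.2) x → x ∈ (fun j => periodize (fun _ : Fin d => P) (cubeFam true L a M ρ k) (j - 1)) j := by
  intro x hx
  rcases h with ⟨hb, -, -⟩ | ⟨hb, -⟩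
  · exact periodize_cubeFam_true_anti' a M ρ k hq (Nat.sub_le j 1) (hb x hx)
  · exact hb x hx

end TowerBonds

/-! ## §2 The Landau condition (1.38): from the periodised tower to the translate cube member -/

section Landau

variable {𝔸 : Type*} [NormedRing 𝔸] [NormedAlgebra ℂ 𝔸] [CompleteSpace 𝔸] {η : ℝ} {U₀ : Site d → Fin d → 𝔸ˣ}

/-- ★★ **THE LANDAU CONDITION (1.38) OF THE PERIODISED TOWER IMPLIES THE ONE OF EVERY TRANSLATE CUBE MEMBER.**  Let `A` satisfy (1.38) in multiplier form
with Dirichlet domain `T = ℤᵈ` and restriction family `Lam L Ωᴾ k` (print's level sets of the periodised tower), and let `A′` agree with `A` on the bonds touching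
`□₀(a + q•v)`.  Then `A′` satisfies (1.38) with Dirichlet domain `□₀(a + q•v)` and the member's families `cubeLamS (a + q•v) … k`: on `□₀ ∖ □₁` the
level-`0` multiplier is free for both conditions; at `x ∈ □₁(a + q•v)` the level-`0` indicators vanish on both sides (`□₁ ⊂ Ωᴾ₁`), the cut-off `𝟙_{□₀}` is
invisible, and for `j ≥ 1` the transpose `Q′_jᵀ(𝟙_{Λ_j}μ_j)(x)` reads `Λ_j` only at the label of the `j`-block of `x`, where `Lam L Ωᴾ k j` and
`cubeLamS (a + q•v) … k j` agree (file (A1) §3) — this seat's g4 `isLandau138_cube_of_univ`, translate-wise.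
[cite: Balaban1985RegularSpaces, (1.38) p.82, (1.131) p.99, (1.5) p.77, p.98; Balaban1985BackgroundPropagators, (3.19) p.393, (3.23)–(3.25) p.394] -/
theorem isLandau138_cube_of_periodize {L : ℕ} (hL : 1 ≤ L) (a : Site d) (M : ℕ) {ρ : ℕ} (hρ : L ≤ ρ) {k P : ℕ} {q : ℤ}
    (hq : (L : ℤ) ^ k * q = P) (hP : L ^ k * M + 2 * (ρ * gs L k) ≤ P) (hk : 1 ≤ k) (v : Site d)
    {A A' : Site d → Fin d → 𝔸} (hagree : ∀ (y : Site d) (τ : Fin d), BondTouches (cube L (a + q • v) M ρ k 0) y τ → A' y τ = A y τ)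
    (hLan : IsLandau138 L k η (Set.univ : Set (Site d))
      (B11Eq7Convention.Lam L (periodize (fun _ : Fin d => P) (cubeFam true L a M ρ k)) k) U₀ A) :
    IsLandau138 L k η (cubeFam false L (a + q • v) M ρ k 0) (cubeLamS L (a + q • v) M ρ k k) U₀ A' := by
  classical
  have hρ1 : 1 ≤ ρ := hL.trans hρ
  obtain ⟨μ, hμ⟩ := hLan
  -- the common tail `Σ_{1 ≤ j ≤ k} Q′_jᵀ(𝟙_{Λ′_j} μ_j)` in the member's families
  set tail : Site d → 𝔸 := fun x => ∑ j ∈ Finset.range k,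
    QprimeT L U₀ (j + 1) ((cubeLamS L (a + q • v) M ρ k k (j + 1)).indicator (μ (j + 1))) x with htail
  set g' : Site d → 𝔸 := (cube L (a + q • v) M ρ k 0).indicator (covDivB η U₀ A') with hg'
  refine ⟨fun j x => if j = 0 then covLap η U₀ g' x - tail x else μ j x, fun x hx => ?_⟩
  rw [cubeFam_false_zero] at hx
  have hRHS : QT L k (cubeLamS L (a + q • v) M ρ k k) U₀ (fun j x => if j = 0 then covLap η U₀ g' x - tail x else μ j x) x =
      (cubeLamS L (a + q • v) M ρ k k 0).indicator (fun x => covLap η U₀ g' x - tail x) x + tail x := by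
    unfold QT
    rw [Finset.sum_range_succ']
    have h1 : ∀ j ∈ Finset.range k, QprimeT L U₀ (j + 1)
        ((cubeLamS L (a + q • v) M ρ k k (j + 1)).indicator
          ((fun (j : ℕ) (x : Site d) => if j = 0 then covLap η U₀ g' x - tail x else μ j x) (j + 1))) x =
        QprimeT L U₀ (j + 1) ((cubeLamS L (a + q • v) M ρ k k (j + 1)).indicator (μ (j + 1))) x := by
      intro j _
      have : (fun (x : Site d) => if j + 1 = 0 then covLap η U₀ g' x - tail x else μ (j + 1) x) = μ (j + 1) := by
        funext y; simp
      simp only [this]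
    rw [Finset.sum_congr rfl h1, add_comm]
    rfl
  rw [cubeFam_false_zero, hRHS]
  by_cases h1 : x ∈ cube L (a + q • v) M ρ k 1
  · -- inside `□₁(a + q•v)`: the level-0 indicators vanish, the cut-off is invisible, the tails agree at the block labels of `x`
    have hx0 : x ∉ cubeLamS L (a + q • v) M ρ k k 0 := by
      rw [cubeLamS_top L _ M ρ (Nat.zero_le k), mem_cubeLam_zero_iff hL _ M ρ hk]; exact fun h => h.2 h1
    rw [Set.indicator_of_notMem hx0, zero_add]
    have hx00 : x ∈ cube L (a + q • v) M ρ k 0 := cube_anti (Nat.zero_le 1) hk h1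
    -- print's condition at `x`
    have hcond := hμ x (Set.mem_univ x)
    have hP' : covLap η U₀ (covDivB η U₀ A) x = tail x := by
      rw [Set.indicator_univ] at hcond
      rw [hcond]
      unfold QT
      rw [Finset.sum_range_succ']
      have h0 : (B11Eq7Convention.Lam L (periodize (fun _ : Fin d => P) (cubeFam true L a M ρ k)) k 0).indicator (μ 0) x = 0 :=
        Set.indicator_of_notMem (fun h => (mem_lam_periodize_zero_iff a M ρ hq hk x).1 h v h1) _
      have e0 : QprimeT L U₀ 0 ((B11Eq7Convention.Lam L (periodize (fun _ : Fin d => P) (cubeFam true L a M ρ k)) k 0).indicator (μ 0)) x =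
          (B11Eq7Convention.Lam L (periodize (fun _ : Fin d => P) (cubeFam true L a M ρ k)) k 0).indicator (μ 0) x := rfl
      rw [e0, h0, add_zero]
      refine Finset.sum_congr rfl fun j hj => ?_
      have hjk : j + 1 ≤ k := Nat.succ_le_of_lt (Finset.mem_range.mp hj)
      have hiff := mem_lam_periodize_iff_cubeLamS hL a M hρ hq hP hx00 (Nat.succ_pos j) hjk
      refine QprimeT_congr_fun U₀ (j + 1) x ?_
      by_cases hm : blockMap (L ^ (j + 1)) x ∈ B11Eq7Convention.Lam L (periodize (fun _ : Fin d => P) (cubeFam true L a M ρ k)) k (j + 1)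
      · rw [Set.indicator_of_mem hm, Set.indicator_of_mem (hiff.1 hm)]
      · rw [Set.indicator_of_notMem hm, Set.indicator_of_notMem (fun h => hm (hiff.2 h))]
    rw [← hP']
    -- the cut-off is invisible at `x ∈ □₁`: the stencil reads `x`, `x ± e_ν`, all in `□₀`, where `A′` and `A` have the same divergence
    have hdiv : ∀ z, z ∈ cube L (a + q • v) M ρ k 0 → g' z = covDivB η U₀ A z := by
      intro z hz
      rw [hg', Set.indicator_of_mem hz]
      exact covDivB_congr_fld z (fun ν => hagree _ _ (Or.inr (by rw [sub_add_cancel]; exact hz))) fun ν => hagree _ _ (Or.inl hz)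
    exact covLap_congr_fld x (hdiv x hx00) (fun ν => hdiv _ (add_e_mem_cube_zero hρ1 hk h1 ν).1)
      fun ν => hdiv _ (add_e_mem_cube_zero hρ1 hk h1 ν).2
  · -- on `□₀ ∖ □₁` the level-0 multiplier is free
    have hx0 : x ∈ cubeLamS L (a + q • v) M ρ k k 0 := by
      rw [cubeLamS_top L _ M ρ (Nat.zero_le k), mem_cubeLam_zero_iff hL _ M ρ hk]; exact ⟨hx, h1⟩
    rw [Set.indicator_of_mem hx0, sub_add_cancel]

end Landau

end Literature.MathematicalPhysics.QuantumFieldTheory.Balaban1983to89.B8Ineq159PeriodizedTowerClass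

end
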